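import Summits.CriticalPhenomena.PercolationContinuityZ3.Theorems.Transplant.SkelFrmBParamsFaceCountsA
import Summits.CriticalPhenomena.PercolationContinuityZ3.Theorems.Transplant.PlanarSkeletonFrmDefs
import Summits.CriticalPhenomena.PercolationContinuityZ3.Theorems.Transplant.SkelPhiStepIDataNS
import HarnessLib
/-!
(F) VALUE LAYER, N2 twin (hp-8 g42, 2026-08-23; F-DISCHARGE-MAP-N2 G18 y′-face counts, (Δ1)/(R-22)): `port_frm.py` text of N1 `SkelNegBParamsFaceCountsYA` (hp-8 g36)
over a generic staggered cell family `(P : PCells2T)` and `SkelFrmBParamsFaceUnits`/`…FaceCountsA` (N2). DELTA as in the x twin: the y′-face's TRANSVERSE target is the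
STAGGERED neighbour centre, `T0Y P x du z := P.cenS (x + stepVec du) 0 − z 0 = P.cenS x 0 + sgOf du·c 1 − z 0` (`cenS_step_zero`), so `T0Y/σTY/N3Y/N3Y_spec` take `du`;
`T1Y/T1Y_eq/NrY/NrY_spec` verbatim over `PCells2T`. `round_count` is N1's.
NON-VACUITY: closed-form definitions + rounding lemmas.
builds on p205010 (kernel theorem, internal audit signed; external expert review pending); nothing here is a claim about the open node `SamePDropOfSkeletonFrm₁`.
N1 HEADER (kept for the reader):
# N1 params, M3′ (the (F) per-centre floors of a **y′-FACE** at the (ζ′) tuple), part 0′ — **THE y′-FACE RUN COUNTS**: the along target `T1Y`,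
# the transverse target `T0Y`, the along count `NrY` of the y′-run, the tangential sign `σTY` and count `N3Y` of the x-run, as CLOSED TERMS of
# (landing origin `yL`, arrival data `x du`, contact point `z`), with their rounding lemmas — the twin of p3-g12's x-face part 0
# `SkelNegBParamsFaceCountsA` (p321289) with the axes exchanged (hp-8 g36, 2026-08-22; y′-face twins per lead 06:53:24Z; consumer = the binder
# `floorsY` of `NegB.faceOblRM_negBTB₄s/₄d/₄t`, HOME prim-hp-8/F-GLUE-CONSUMER-SHAPE.md §3).

The y′-face route of a contact at `z` (arrival `(x, du)`, `du.1 = 1`, run sign `σ = sgOf du`): bridge → along y′-run of `Nr + 1` regions from the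
landing origin `yL` (nominal level advance `m` per region, i.e. `u₁` in the axis-1 reading `KS.F1cA`; the regions' true envelopes carry a bounded
error, which stays in the field lemmas FA·) → tangential x-run of `N₃ + 1` strides `u = (n_L, h_L)` from `yT := yL + Skelφ.crossOffY n_L ℓ_L h_L v_L σ Nr`
(`u`-strides keep `Λ₁`, add exactly `u₀` to `KS.FcA`) → last core in the arrival box centred at `cen (x + e_du)`.
* `T1Y x du z := cen (x + stepVec du) 1 − z 1` (`σ·T1Y = 20r₁ − lev du x z`, `T1Y_eq`), `T0Y x z := cen x 0 − z 0` (`cen_step_zero`: the along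
  step does not move axis `0`) — the arrival targets relative to the contact;
* `NrY yL x du z := toNat((σ·(T1Y − F1cA yL) + u₁/2)/u₁ − 1)` with `NrY_spec`: if the along target is at least one region ahead
  (`u₁ ≤ σ·(T1Y − F1cA yL)`) then `|F1cA yL + σ·u₁·(NrY+1) − T1Y| ≤ u₁` and `u₁·(NrY + 1) ≤ σ·(T1Y − F1cA yL) + u₁` (nominal positions);
* `σTY yL x z := if FcA yL ≤ T0Y then 1 else −1`; `N3Y yL x z := toNat((|T0Y − FcA yL| + u₀/2)/u₀ − 1)` with `N3Y_spec`: `σTY = ±1`,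
  `u₀·(N3Y + 1) ≤ |T0Y − FcA yL| + 2u₀`, `|FcA yL + σTY·u₀·(N3Y+1) − T0Y| ≤ 2u₀` (the tangential origin's reading `FcA yT` differs from
  `FcA yL` by the cross-shift discrepancy, bounded separately — part 1b′).
builds on p205010 (kernel theorem, internal audit signed; external expert review pending) — nothing in this file uses p205010; NOTHING is claimed about the node
`SamePDropOfSkeletonNeg₁` (OPEN); values + arithmetic only.
Lane `prim-bschramm`, seat `prim-hp-8` (gen 36); helper file (`--supports stmt-CriticalPhenomena-4575 --as helper`); slot-ledger ζ′ v1/v2.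
[cite: KozmaNitzan2024, §4 Lemma 11 (p. 22), Lemma 12 (pp. 23–25)] [cite: MartineauTassion2017, §4.1]
-/

noncomputable section

open scoped Classical

namespace Summit.CriticalPhenomena.PercolationContinuityZ3.Theorems.Transplant

namespace PlanarSkeletonFrm

namespace NegB

open Literature.Probability.Percolation Literature.Probability.LatticeModels SimpleGraph
open Literature.Probability.Percolation.KozmaNitzan.Cells (oth sgOf sgOf_sign stepVec_apply_fst stepVec_apply_oth)
open SkelConc (Consts)
open Skelφ.StepI (DataN)
open TwoAxis.Para (modulus)
open Neg

namespace KS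

section FaceCountsY

/-- **The along target of a y′-face contact**: the arrival box centre minus the contact point, axis `1`. [this work] -/
def T1Y (P : PCells2T) (x : Site 2) (du : MDir) (z : Site 2) : ℤ := P.cenS (x + stepVec du) 1 - z 1

/-- **The transverse target of a y′-face contact**: the arrival cell's centre minus the contact point, axis `0`. [this work] -/
def T0Y (P : PCells2T) (x : Site 2) (du : MDir) (z : Site 2) : ℤ := P.cenS (x + stepVec du) 0 - z 0

/-- **The along count of the y′-run** `NrY := round(σ·(T1Y − F1cA yL)/u₁) − 1` (clipped at `0`). [this work] -/
def NrY (κ : Consts) {V : Type} [DecidableEq V] [Countable V] {G : SimpleGraph V} [G.LocallyFinite] (Φ : PlanarSkeletonFrm G) (t : V) (p : unitInterval) (D : Skelφ.StepI.DataNS V) (g : ℕ) (f : ℕ) (P : PCells2T) (yL : Site 2) (x : Site 2) (du : MDir) (z : Site 2) : ℕ :=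
  Int.toNat ((sgOf du * (T1Y P x du z - F1cA κ Φ t p D g f yL) + u₁A κ Φ t p D g f / 2) / u₁A κ Φ t p D g f - 1)

/-- **The tangential sign of the x-run**: towards the transverse target from the landing origin's abscissa reading. [this work] -/
def σTY (κ : Consts) {V : Type} [DecidableEq V] [Countable V] {G : SimpleGraph V} [G.LocallyFinite] (Φ : PlanarSkeletonFrm G) (t : V) (p : unitInterval) (D : Skelφ.StepI.DataNS V) (g : ℕ) (f : ℕ) (P : PCells2T) (yL x : Site 2) (du : MDir) (z : Site 2) : ℤ := if FcA κ Φ t p D g f yL ≤ T0Y P x du z then 1 else -1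

/-- **The tangential count of the x-run** `N3Y := round(|T0Y − FcA yL|/u₀) − 1` (clipped at `0`). [this work] -/
def N3Y (κ : Consts) {V : Type} [DecidableEq V] [Countable V] {G : SimpleGraph V} [G.LocallyFinite] (Φ : PlanarSkeletonFrm G) (t : V) (p : unitInterval) (D : Skelφ.StepI.DataNS V) (g : ℕ) (f : ℕ) (P : PCells2T) (yL x : Site 2) (du : MDir) (z : Site 2) : ℕ :=
  Int.toNat ((|T0Y P x du z - FcA κ Φ t p D g f yL| + u₀A κ Φ t p D g f / 2) / u₀A κ Φ t p D g f - 1)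

/-- **`σ·T1Y = 20·r₁ − lev`** for a y′-direction `du` (`du.1 = 1`). [folklore] -/
theorem T1Y_eq (P : PCells2T) (x : Site 2) (du : MDir) (hd : du.1 = 1) (z : Site 2) :
    sgOf du * T1Y P x du z = 20 * (P.r 1 : ℤ) - P.lev du x z := by
  have hσ : sgOf du * sgOf du = 1 := by rcases sgOf_sign du with h | h <;> simp [h]
  have hc := PCells2T.cenS_add_stepVec_fst P x du
  rw [hd] at hc
  unfold T1Y PCells2T.lev
  rw [hd, hc]
  linear_combination (20 * (P.r 1 : ℤ)) * hσ

/-- **`T0Y` SEES the along step through the creep**: `cenS (x + stepVec du) 0 = cenS x 0 + sgOf du · c 1` for `du.1 = 1` (N1's `cen_step_zero` had no creep). [folklore] -/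
theorem cenS_step_zero (P : PCells2T) (x : Site 2) (du : MDir) (hd : du.1 = 1) :
    P.cenS (x + stepVec du) 0 = P.cenS x 0 + sgOf du * P.c 1 := by
  have h := PCells2T.cenS_add_stepVec_oth P x du
  rw [hd, show oth (1 : Fin 2) = 0 from rfl] at h
  exact h

/-- **The tangential choice of the x-run is admissible**: `σTY = ±1`; `u₀·(N3Y+1) ≤ |T0Y − FcA yL| + 2u₀`; and the x-run's nominal end reading is
within two strides of the transverse target, `|FcA yL + σTY·u₀·(N3Y+1) − T0Y| ≤ 2u₀`. [folklore] -/
theorem N3Y_spec (κ : Consts) {V : Type} [DecidableEq V] [Countable V] {G : SimpleGraph V} [G.LocallyFinite] (Φ : PlanarSkeletonFrm G) (t : V) (p : unitInterval) (D : Skelφ.StepI.DataNS V) (g : ℕ) (f : ℕ) (P : PCells2T) (yL x : Site 2) (du : MDir) (z : Site 2) :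
    (σTY κ Φ t p D g f P yL x du z = 1 ∨ σTY κ Φ t p D g f P yL x du z = -1) ∧
      u₀A κ Φ t p D g f * ((N3Y κ Φ t p D g f P yL x du z : ℤ) + 1) ≤ |T0Y P x du z - FcA κ Φ t p D g f yL| + 2 * u₀A κ Φ t p D g f ∧
      |FcA κ Φ t p D g f yL + σTY κ Φ t p D g f P yL x du z * u₀A κ Φ t p D g f * ((N3Y κ Φ t p D g f P yL x du z : ℤ) + 1) - T0Y P x du z| ≤ 2 * u₀A κ Φ t p D g f := by
  have hu : 1 ≤ u₀A κ Φ t p D g f := (units_eqA κ Φ t p D g f).2.2.2.2.1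
  set u := u₀A κ Φ t p D g f
  set T := T0Y P x du z
  set F := FcA κ Φ t p D g f yL
  have hσ : σTY κ Φ t p D g f P yL x du z = 1 ∨ σTY κ Φ t p D g f P yL x du z = -1 := by unfold σTY; split_ifs <;> simp
  refine ⟨hσ, ?_⟩
  obtain ⟨d1, d2⟩ := PlanarSkeletonNeg.NegB.RootArith.floor_sandwich (x := u) (d := 2) (by norm_num)
  by_cases hfar : u ≤ |T - F|
  · obtain ⟨r1, r2⟩ := round_count (X := |T - F|) (by linarith) hfar
    have hN : (N3Y κ Φ t p D g f P yL x du z : ℤ) = ((Int.toNat ((|T - F| + u / 2) / u - 1) : ℕ) : ℤ) := rfl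
    rw [hN]
    refine ⟨by linarith, ?_⟩
    set M : ℤ := ((Int.toNat ((|T - F| + u / 2) / u - 1) : ℕ) : ℤ)
    obtain ⟨a1, a2⟩ := abs_le.1 r1
    unfold σTY
    split_ifs with hle
    · rw [abs_of_nonneg (by linarith : (0:ℤ) ≤ T - F)] at a1 a2
      rw [abs_le]; constructor <;> linarith
    · push Not at hle
      rw [abs_of_neg (by linarith : T - F < 0)] at a1 a2
      rw [abs_le]; constructor <;> linarith
  · -- the target is within one stride: the count is `0`
    push Not at hfar
    obtain ⟨x1, x2⟩ := PlanarSkeletonNeg.NegB.RootArith.floor_sandwich (x := |T - F| + u / 2) (d := u) (by linarith)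
    have hY : (|T - F| + u / 2) / u - 1 ≤ 0 := by
      by_contra hc; push Not at hc
      have : u * 2 ≤ u * ((|T - F| + u / 2) / u) := mul_le_mul_of_nonneg_left (by linarith) (by linarith)
      linarith [abs_nonneg (T - F)]
    have hN : (N3Y κ Φ t p D g f P yL x du z : ℤ) = 0 := by
      show ((Int.toNat ((|T - F| + u / 2) / u - 1) : ℕ) : ℤ) = 0
      rw [Int.toNat_of_nonpos hY]; rfl
    rw [hN, zero_add, mul_one]
    refine ⟨by linarith [abs_nonneg (T - F)], ?_⟩
    have hab := abs_le.1 (le_of_lt hfar)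
    rcases hσ with h | h <;> rw [h] <;> rw [abs_le] <;> constructor <;> linarith

/-- **The along choice of the y′-run is admissible** (target at least one region ahead of the landing origin): the run's nominal end reading is
within one region of the along target and the count is bounded by the distance. [cite: KozmaNitzan2024, §4 Lemma 11 (p. 22)] -/
theorem NrY_spec (κ : Consts) {V : Type} [DecidableEq V] [Countable V] {G : SimpleGraph V} [G.LocallyFinite] (Φ : PlanarSkeletonFrm G) (t : V) (p : unitInterval) (D : Skelφ.StepI.DataNS V) (g : ℕ) (f : ℕ) (P : PCells2T) (yL : Site 2) (x : Site 2) (du : MDir) (z : Site 2)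
    (hX : u₁A κ Φ t p D g f ≤ sgOf du * (T1Y P x du z - F1cA κ Φ t p D g f yL)) :
    |F1cA κ Φ t p D g f yL + sgOf du * u₁A κ Φ t p D g f * ((NrY κ Φ t p D g f P yL x du z : ℤ) + 1) - T1Y P x du z| ≤ u₁A κ Φ t p D g f ∧
      u₁A κ Φ t p D g f * ((NrY κ Φ t p D g f P yL x du z : ℤ) + 1) ≤ sgOf du * (T1Y P x du z - F1cA κ Φ t p D g f yL) + u₁A κ Φ t p D g f := by
  have hu : 1 ≤ u₁A κ Φ t p D g f := (units_eqA κ Φ t p D g f).2.2.2.2.2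
  have hσ : sgOf du = 1 ∨ sgOf du = -1 := sgOf_sign du
  set u := u₁A κ Φ t p D g f
  set T := T1Y P x du z
  set F := F1cA κ Φ t p D g f yL
  obtain ⟨r1, r2⟩ := round_count (X := sgOf du * (T - F)) (by linarith) hX
  have hNr : (NrY κ Φ t p D g f P yL x du z : ℤ) = ((Int.toNat ((sgOf du * (T - F) + u / 2) / u - 1) : ℕ) : ℤ) := rfl
  rw [hNr]
  refine ⟨?_, r2⟩
  set M : ℤ := ((Int.toNat ((sgOf du * (T - F) + u / 2) / u - 1) : ℕ) : ℤ)
  obtain ⟨a1, a2⟩ := abs_le.1 r1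
  rcases hσ with h | h <;> rw [h] at a1 a2 ⊢ <;> rw [abs_le] <;> constructor <;> linarith

end FaceCountsY

end KS

end NegB

end PlanarSkeletonFrm

end Summit.CriticalPhenomena.PercolationContinuityZ3.Theorems.Transplant

end
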